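import Literature.NumberTheory.Automorphic.ArchRankOneCasimirUniform       -- ★ p850750 (LH3-p04 (g4)) (ELL-∞-UNIF): `exists_forall_eventually_norm_iteratedDeriv_orbitalIntegral_comp_clm_le`
import Literature.Analysis.Calculus.ContDiffBoundedFamilyLpInfty           -- ★ p850983 (LH7-p02 (g4)) (B2a): `exists_contDiff_hasCompactSupport_lpInfty_of_bounds_on`
import HarnessLib

/-!
# (ELL-∞-UNIF) OVER A COMPACT SMOOTH FAMILY: the jets of the normalised elliptic orbital integral `F (Θ_q)` are bounded near the compact wall UNIFORMLY in the parameter `q ∈ K`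
# (Varadarajan 1989 §6.4 Thms 22–24; Bouaziz 1994 §3.1 (I₁)–(I₂) «ainsi que toutes ses dérivées y sont bornées», uniformly in the transversal variables)

Topic `NumberTheory/Automorphic`; namespaces `Literature.Analysis.Calculus` (§A, frame-free) and `Literature.NumberTheory.Automorphic.RankOneCasimir` (§B).  THEOREMS ONLY (no `def`,
no instance, no notation, no axiom, no named fact, no `sorry`).  Cell `pub/hodgecm-mathlib`, crux H413 (`stmt-HodgeConjecture-24833`), F0∕P3c line LH3 (closer stub `stub_N9`,
DIRECT ROAD), LETTER L1 clause (I₁) at the FACES: the one new analytic input of brick **(B2) «FACES WITH PARAMETERS» ED. 2** (LH7-p04 (g4)'s (I₁-CENSUS) ∕ LH3-plan (g3) RULING #15;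
(I₁) spec-owner «= binder» 2026-09-02T10:30:17Z), seat LH3-p02 (g4).  Count-neutral.

THE MATHEMATICS.  ★ (ELL-∞-UNIF) `exists_forall_eventually_norm_iteratedDeriv_orbitalIntegral_comp_clm_le` (LH3-p04): for ONE `g ∈ C_c^∞(M₂(ℂ), E′)` the `n`-th `ψ`-derivatives of the
normalised rank-one elliptic orbital integrals `F (ℓ ∘ g)` are bounded by `‖ℓ‖ · B` on ONE punctured neighbourhood of the compact wall `ψ = 0`, simultaneously for all CLMs
`ℓ : E′ →L E`.  ★ (B2a) `exists_contDiff_hasCompactSupport_lpInfty_of_bounds_on` (LH7-p02): a family `q ↦ Θ_q ∈ C_c^∞(M, E)`, `q ∈ K`, with jets bounded uniformly in `q` IS one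
`G ∈ C_c^∞(M, ℓ^∞(↥K, E))` with `ev_q ∘ G = Θ_q`, `‖ev_q‖ ≤ 1`.  For a JOINTLY smooth family `Θ : P → M → E` vanishing off one compact `C`, the jets of `uncurry Θ` are bounded on the
compact `K ×ˢ C` and dominate the partial jets of `Θ_q` (chain rule along `X ↦ (q, X)`), so the two ★ compose:
* §A (frame-free) **`Literature.Analysis.Calculus.exists_forall_eventually_norm_iteratedDeriv_le_of_contDiff_family`** — for ANY functional `F : (M → E) → ℝ → E` satisfying the
  (ELL-∞-UNIF)-type hypothesis `hunif` at `E′ := ℓ^∞(↥K, E)`: `∃ B, ∀ᶠ ψ in 𝓝[≠] 0, ∀ q ∈ K, ‖(F (Θ q))⁽ⁿ⁾ ψ‖ ≤ B` (ONE universe `Type`, as (B2a));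
* §B **`RankOneCasimir.exists_forall_eventually_norm_iteratedDeriv_orbitalIntegral_le_of_contDiff_family`** — the rank-one elliptic orbital integral in the frame of ★ (ELL-∞)
  (binders VERBATIM; `hunif` discharged by ★ §4 with the `E′`-valued functional and Casimir built in-proof from their defining formulae): the (I₁) model bound at a face, UNIFORM in
  the transversal coordinates `q` — the family class `(Θ, ContDiff ℝ ∞ (uncurry Θ), one compact support)` is that of SPEC-I3 §2 ∕ ★ (B-par) ∕ ★-pending (B-desc) box p851016.
HONEST LABEL: HC_CM is proved only modulo the 7 printed citations (2 remaining: hLiu418 = `stmt-HodgeConjecture-24832`, h413 = `stmt-HodgeConjecture-24833`) until rung 0 closes;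
bookkeeping over ★ p850750 ∕ p850983, pays nothing by itself.

## References
* [Varadarajan1989] V. S. Varadarajan, *An Introduction to Harmonic Analysis on Semisimple Lie Groups*, Cambridge Stud. Adv. Math. 16 (1989), §6.4 Thms 22–24.
* [Bouaziz1994IntegralesOrbitales] A. Bouaziz, *Intégrales orbitales sur les groupes de Lie réductifs*, Ann. Sci. ÉNS 27 (1994), §3.1 (I₁)–(I₂) p. 579.
* [Rogawski1990] J. D. Rogawski, *Automorphic Representations of Unitary Groups in Three Variables*, Ann. of Math. Stud. 123 (1990), §8.2 pp. 119–123.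
* [HormanderALPDO1] L. Hörmander, *The Analysis of Linear Partial Differential Operators I*, 2nd ed. (1990), §1.1 (1.1.8) (chain rule for higher derivatives), §2.1.
-/

set_option autoImplicit false

noncomputable section

open Set Filter Topology Function MeasureTheory
open scoped ContDiff

/-! ## §A Frame-free: a compact smooth family is ONE `C_c^∞` map into `ℓ^∞(↥K, E)`, so a CLM-uniform bound is a `q`-uniform bound -/

namespace Literature.Analysis.Calculus

/-- **FRAME-FREE UNIFORMITY OVER A COMPACT SMOOTH FAMILY.**  Let `F : (M → E) → ℝ → E` be ANY «functional» for which the (ELL-∞-UNIF)-type statement holds at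
`E′ := ℓ^∞(↥K, E)`: for every `G ∈ C_c^∞(M, E′)` one constant `B` bounds `‖(F (ℓ ∘ G))⁽ⁿ⁾ ψ‖ ≤ ‖ℓ‖ · B` on ONE punctured neighbourhood of `ψ = 0` for all CLMs `ℓ : E′ →L E`
(hypothesis `hunif` — ★ `RankOneCasimir.exists_forall_eventually_norm_iteratedDeriv_orbitalIntegral_comp_clm_le` is this for the rank-one elliptic orbital integral).  Then for every
JOINTLY smooth family `Θ : P → M → E` (`ContDiff ℝ ∞ (uncurry Θ)`) whose members vanish off ONE compact `C`, and every compact `K ⊆ P`: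
`∃ B, ∀ᶠ ψ in 𝓝[≠] 0, ∀ q ∈ K, ‖(F (Θ q))⁽ⁿ⁾ ψ‖ ≤ B`.  Proof: the jets of `uncurry Θ` are bounded on the compact `K ×ˢ C` (continuity), the partial jets of `Θ q` are bounded by
them (chain rule along `X ↦ (q, X)`), so ★ (B2a) `exists_contDiff_hasCompactSupport_lpInfty_of_bounds_on` packages `q ↦ Θ q`, `q ∈ K`, as ONE `G ∈ C_c^∞(M, ℓ^∞(↥K, E))` with
`ev_q ∘ G = Θ q`, `‖ev_q‖ ≤ 1`; apply `hunif`. [cite: Varadarajan1989, §6.4 Thm 22] [cite: Bouaziz1994IntegralesOrbitales, §3.1 (I₁)–(I₂) p. 579] [cite: HormanderALPDO1, §1.1 (1.1.8)] -/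
theorem exists_forall_eventually_norm_iteratedDeriv_le_of_contDiff_family
    {P M E : Type} [NormedAddCommGroup P] [NormedSpace ℝ P] [NormedAddCommGroup M] [NormedSpace ℝ M] [NormedAddCommGroup E] [NormedSpace ℝ E]
    (F : (M → E) → ℝ → E) {K : Set P} (hK : IsCompact K) (n : ℕ)
    (hunif : ∀ G : M → lp (fun _ : ↥K => E) ⊤, ContDiff ℝ ∞ G → HasCompactSupport G →
      ∃ B : ℝ, ∀ᶠ ψ in 𝓝[≠] (0 : ℝ), ∀ ℓ : lp (fun _ : ↥K => E) ⊤ →L[ℝ] E, ‖iteratedDeriv n (F (fun X => ℓ (G X))) ψ‖ ≤ ‖ℓ‖ * B)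
    (Θ : P → M → E) (hΘ : ContDiff ℝ ∞ (uncurry Θ)) {C : Set M} (hC : IsCompact C) (hΘC : ∀ q X, X ∉ C → Θ q X = 0) :
    ∃ B : ℝ, ∀ᶠ ψ in 𝓝[≠] (0 : ℝ), ∀ q ∈ K, ‖iteratedDeriv n (F (Θ q)) ψ‖ ≤ B := by
  -- the family indexed by `↥K`
  set g : ↥K → M → E := fun y => Θ y.1 with hg
  have hslice : ∀ q : P, Θ q = (fun z : P × M => uncurry Θ (z + (q, 0))) ∘ (ContinuousLinearMap.inr ℝ P M) := by
    intro q
    funext X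
    simp only [comp_apply, ContinuousLinearMap.inr_apply, Prod.mk_add_mk, zero_add, add_zero, uncurry_apply_pair]
  have hT : ∀ q : P, ContDiff ℝ ∞ fun z : P × M => uncurry Θ (z + (q, 0)) := fun q => hΘ.comp (contDiff_id.add contDiff_const)
  have hgs : ∀ y : ↥K, ContDiff ℝ ∞ (g y) := fun y => by
    show ContDiff ℝ ∞ (Θ y.1)
    rw [hslice y.1]
    exact (hT y.1).comp (ContinuousLinearMap.inr ℝ P M).contDiff
  have hsupp : ∀ y : ↥K, tsupport (g y) ⊆ C := fun y =>
    closure_minimal (fun X hX => by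
      by_contra hXC
      exact hX (hΘC y.1 X hXC)) hC.isClosed
  -- uniform jet bounds on `C`: partial jets ≤ full jets of `uncurry Θ`, bounded on the compact `K ×ˢ C`
  have hbd : ∀ m : ℕ, ∃ B : ℝ, ∀ y : ↥K, ∀ X ∈ C, ‖iteratedFDeriv ℝ m (g y) X‖ ≤ B := by
    intro m
    obtain ⟨B, hB⟩ := (hK.prod hC).exists_bound_of_continuousOn
      ((hΘ.continuous_iteratedFDeriv (m := m) (mod_cast le_top)).continuousOn (s := K ×ˢ C))
    refine ⟨‖ContinuousLinearMap.inr ℝ P M‖ ^ m * B, fun y X hX => ?_⟩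
    have hq : iteratedFDeriv ℝ m (g y) X =
        (iteratedFDeriv ℝ m (fun z : P × M => uncurry Θ (z + ((y : P), 0))) (ContinuousLinearMap.inr ℝ P M X)).compContinuousLinearMap
          fun _ => ContinuousLinearMap.inr ℝ P M := by
      show iteratedFDeriv ℝ m (Θ y.1) X = _
      rw [hslice (y : P)]
      exact (ContinuousLinearMap.inr ℝ P M).iteratedFDeriv_comp_right (hT y.1) X (mod_cast le_top)
    rw [hq]
    refine (ContinuousMultilinearMap.norm_compContinuousLinearMap_le _ _).trans ?_
    rw [Finset.prod_const, Finset.card_univ, Fintype.card_fin, iteratedFDeriv_comp_add_right, mul_comm]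
    refine mul_le_mul_of_nonneg_left ?_ (pow_nonneg (norm_nonneg _) _)
    have hmem : ((ContinuousLinearMap.inr ℝ P M X) + ((y : P), (0 : M))) ∈ K ×ˢ C := by
      simp only [ContinuousLinearMap.inr_apply, Prod.mk_add_mk, zero_add, add_zero]
      exact ⟨y.2, hX⟩
    exact hB _ hmem
  obtain ⟨G, hG, hGs, hGc, -, hev⟩ := exists_contDiff_hasCompactSupport_lpInfty_of_bounds_on g hgs hC hsupp hbd
  obtain ⟨B, hB⟩ := hunif G hGs hGc
  refine ⟨max B 0, ?_⟩
  filter_upwards [hB] with ψ hψ q hq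
  obtain ⟨ℓ, hℓ, hℓG⟩ := hev ⟨q, hq⟩
  have hfun : (fun X => ℓ (G X)) = Θ q := funext fun X => by rw [hℓG X]
  have h := hψ ℓ
  rw [hfun] at h
  exact h.trans ((mul_le_mul_of_nonneg_left (le_max_left B 0) (norm_nonneg ℓ)).trans
    (by nlinarith [hℓ, le_max_right B 0, norm_nonneg ℓ]))

end Literature.Analysis.Calculus

/-! ## §B The rank-one elliptic orbital integral (frame of ★ (ELL-∞)): bounded jets near the compact wall UNIFORMLY over a compact smooth family -/

namespace Literature.NumberTheory.Automorphic.RankOneCasimir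

open _root_.Complex _root_.Matrix _root_.NumberField _root_.NumberField.InfinitePlace
open _root_.Literature.NumberTheory.Automorphic _root_.Literature.NumberTheory.Automorphic.UnitaryGroup
open scoped Matrix.Norms.Operator MatrixGroups ComplexConjugate

variable (L : Type) [Field L] (a : Fin 2 → L) (w : {w : InfinitePlace L // IsComplex w})
variable {E : Type} [NormedAddCommGroup E] [NormedSpace ℝ E] [CompleteSpace E]

/-- **(ELL-∞-UNIF) OVER A COMPACT SMOOTH FAMILY.**  For a JOINTLY smooth family `Θ : P → M₂(ℂ) → E` of test functions vanishing off ONE compact set (the family class of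
SPEC-I3 §2 ∕ (B-par)), every compact set `K` of parameters and every order `n` there is ONE constant `B` with `‖(F (Θ q))⁽ⁿ⁾ ψ‖ ≤ B` on ONE punctured neighbourhood of the
compact wall `ψ = 0`, for ALL `q ∈ K` — ★ `exists_forall_eventually_norm_iteratedDeriv_orbitalIntegral_comp_clm_le` read at `E′ := ℓ^∞(↥K, E)` through ★ (B2a) (§A).  This is
Bouaziz (I₁) for the model family at a face: the rank-one bound is uniform in the transversal coordinates. [cite: Varadarajan1989, §6.4 Thm 22]
[cite: Bouaziz1994IntegralesOrbitales, §3.1 (I₁)–(I₂) p. 579] [cite: Rogawski1990, §8.2 p. 122] -/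
theorem exists_forall_eventually_norm_iteratedDeriv_orbitalIntegral_le_of_contDiff_family
    (ha : ∀ i, a i ≠ 0) (hreal : ∀ i, (w.1.embedding (a i)).im = 0) (hsgn : (w.1.embedding (a 0)).re * (w.1.embedding (a 1)).re < 0)
    {p q : ℝ} (hpq : p * q = 1) (hqe : (q : ℂ) ^ 2 * w.1.embedding (a 1) = -w.1.embedding (a 0))
    [MeasurableSpace (unitaryGroupOfForm (starRingEnd ℂ) ((Matrix.diagonal a).map w.1.embedding))]
    [BorelSpace (unitaryGroupOfForm (starRingEnd ℂ) ((Matrix.diagonal a).map w.1.embedding))]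
    (μ : Measure (unitaryGroupOfForm (starRingEnd ℂ) ((Matrix.diagonal a).map w.1.embedding))) [μ.IsHaarMeasure] [μ.IsMulRightInvariant]
    (z : Circle) (F : (Matrix (Fin 2) (Fin 2) ℂ → E) → ℝ → E)
    (hF : ∀ (f : Matrix (Fin 2) (Fin 2) ℂ → E) (ψ : ℝ), F f ψ = (2 * Real.sin ψ) •
      ∫ h : unitaryGroupOfForm (starRingEnd ℂ) ((Matrix.diagonal a).map w.1.embedding),
        f (((h * ⟨circleDiagonal 2 ![z * Circle.exp ψ, z * Circle.exp (-ψ)], circleDiagonal_mem_archLocal_diagonal L 2 a w _⟩ * h⁻¹ :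
          unitaryGroupOfForm (starRingEnd ℂ) ((Matrix.diagonal a).map w.1.embedding)) : GL (Fin 2) ℂ) : Matrix (Fin 2) (Fin 2) ℂ) ∂μ)
    {P : Type} [NormedAddCommGroup P] [NormedSpace ℝ P] {K : Set P} (hK : IsCompact K)
    (Θ : P → Matrix (Fin 2) (Fin 2) ℂ → E) (hΘ : ContDiff ℝ ∞ (uncurry Θ)) {C : Set (Matrix (Fin 2) (Fin 2) ℂ)} (hC : IsCompact C) (hΘC : ∀ q X, X ∉ C → Θ q X = 0) (n : ℕ) :
    ∃ B : ℝ, ∀ᶠ ψ in 𝓝[≠] (0 : ℝ), ∀ q ∈ K, ‖iteratedDeriv n (F (Θ q)) ψ‖ ≤ B := by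
  refine Literature.Analysis.Calculus.exists_forall_eventually_norm_iteratedDeriv_le_of_contDiff_family F hK n (fun G hGs hGc => ?_) Θ hΘ hC hΘC
  -- the `E′ := ℓ^∞(↥K, E)`-valued functional and Casimir (their defining formulae, no definitions)
  obtain ⟨F', hF'⟩ : ∃ F' : (Matrix (Fin 2) (Fin 2) ℂ → lp (fun _ : ↥K => E) ⊤) → ℝ → lp (fun _ : ↥K => E) ⊤,
      ∀ (g : Matrix (Fin 2) (Fin 2) ℂ → lp (fun _ : ↥K => E) ⊤) (ψ : ℝ), F' g ψ = (2 * Real.sin ψ) •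
        ∫ h : unitaryGroupOfForm (starRingEnd ℂ) ((Matrix.diagonal a).map w.1.embedding),
          g (((h * ⟨circleDiagonal 2 ![z * Circle.exp ψ, z * Circle.exp (-ψ)], circleDiagonal_mem_archLocal_diagonal L 2 a w _⟩ * h⁻¹ :
            unitaryGroupOfForm (starRingEnd ℂ) ((Matrix.diagonal a).map w.1.embedding)) : GL (Fin 2) ℂ) : Matrix (Fin 2) (Fin 2) ℂ) ∂μ :=
    ⟨fun g ψ => _, fun _ _ => rfl⟩
  obtain ⟨Ω', hΩ'⟩ : ∃ Ω' : (Matrix (Fin 2) (Fin 2) ℂ → lp (fun _ : ↥K => E) ⊤) → Matrix (Fin 2) (Fin 2) ℂ → lp (fun _ : ↥K => E) ⊤,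
      ∀ (g : Matrix (Fin 2) (Fin 2) ℂ → lp (fun _ : ↥K => E) ⊤) (Y : Matrix (Fin 2) (Fin 2) ℂ), Ω' g Y =
        -(fderiv ℝ (fderiv ℝ g) Y (Y * !![I, 0; 0, -I]) (Y * !![I, 0; 0, -I]) + fderiv ℝ g Y (Y * !![I, 0; 0, -I] * !![I, 0; 0, -I])) +
          (fderiv ℝ (fderiv ℝ g) Y (Y * !![(0 : ℂ), (p : ℂ); (q : ℂ), 0]) (Y * !![(0 : ℂ), (p : ℂ); (q : ℂ), 0]) +
            fderiv ℝ g Y (Y * !![(0 : ℂ), (p : ℂ); (q : ℂ), 0] * !![(0 : ℂ), (p : ℂ); (q : ℂ), 0])) +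
          (fderiv ℝ (fderiv ℝ g) Y (Y * !![(0 : ℂ), -((p : ℂ) * I); (q : ℂ) * I, 0]) (Y * !![(0 : ℂ), -((p : ℂ) * I); (q : ℂ) * I, 0]) +
            fderiv ℝ g Y (Y * !![(0 : ℂ), -((p : ℂ) * I); (q : ℂ) * I, 0] * !![(0 : ℂ), -((p : ℂ) * I); (q : ℂ) * I, 0])) :=
    ⟨fun g Y => _, fun _ _ => rfl⟩
  obtain ⟨B, -, hB⟩ := exists_forall_eventually_norm_iteratedDeriv_orbitalIntegral_comp_clm_le L a w ha hreal hsgn hpq hqe μ Ω' hΩ' z F hF F' hF' hGs hGc n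
  exact ⟨B, hB⟩

end Literature.NumberTheory.Automorphic.RankOneCasimir

end
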